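import Summits.CriticalPhenomena.CardyFormulaZ2.Theorems.HalfPlaneMarkDensityLaw.Negative.MarkEvents
import Literature.Probability.Percolation.HalfPlaneOneArmQuasiMultiplicativity
import Literature.Probability.Percolation.HalfPlaneArmAxisInputs
import HarnessLib

/-!
# Line `Sketch` — crux 5 ⟹ crux 6, lattice stub: the half-annulus block crossing is bounded
# above by a row-to-row half-plane crossing (crux stmt-CriticalPhenomena-5661, lead c10-0/c11-0)

In the axis coordinates `X v = v 0`, `Y v = v 1` of bond-`ℤ²` with base point `0`, write
`ν v = max |v 0 - 0| (v 1 - 0)` for the half-plane sup-norm,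
`ann₀[r, R] = {0 ≤ v 1 ∧ r ≤ ν v ∧ ν v ≤ R}` for the upper half-annulus,
`E₀[r, R] = openCrossing ann₀[r, R] {ν = r} {ν = R}` for its block crossing event, and `U₀[a]` for
the U event at scale `a` based at `0`: the right pillar `[a, 2a] × [0, 2a]` and the left pillar
`[-2a, -a] × [0, 2a]` are crossed from bottom to top and the bar `[-2a, 2a] × [a, 2a]` from left
to right by open paths (the event of `HalfPlaneArm.uCatch` / `HalfPlaneArm.real_U_ge`).

* `stub_upperBlock`: there are `c > 0` and `m₀` with
  `c · P_{1/2}(E₀[r, R]) ≤ P_{1/2}[[r, 2r]×{0} ↔ [a, 2a]×{0} in ℤ×ℕ]` for `m₀ ≤ r ≤ a`, `2a ≤ R`.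
  Deterministic half (`stub_upperBlock_aux_mem`): on a lattice configuration in
  `E₀[r, R] ∩ U₀[r] ∩ U₀[a]` the block crossing runs from `{ν = r} ⊆ {ν ≤ s}` to
  `{ν = R} ⊆ {2s ≤ ν}` for both `s = r` and `s = a`, so the U at scale `s` catches it
  (`HalfPlaneArm.uCatch`: the starting point is joined inside the half-plane to the left end of
  the bar crossing), the bar crossing meets the right pillar crossing (`HalfPlaneArm.meet`), whose
  lower end is a vertex of the bottom-row segment `[s, 2s] × {0}` (`stub_upperBlock_aux_foot`);
  chaining the two feet through the starting point gives an open path of `ℤ×ℕ` from `[r, 2r]×{0}`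
  to `[a, 2a]×{0}`. Probabilistic half: the three events are increasing, `P_{1/2}(U₀[s]) ≥ c_U`
  for `s ≥ m_U` (`HalfPlaneArm.real_U_ge`, RSW at `p = 1/2`), and Harris–FKG
  (`HalfPlaneArm.harris₃`) gives `c_U² · P(E₀[r, R]) ≤ P(E₀[r, R] ∩ U₀[r] ∩ U₀[a])`.
-/

noncomputable section

namespace Summit.CriticalPhenomena.CardyFormulaZ2.Cruxes.HalfPlaneMarkDensityLaw.SketchLine

open Literature.Probability.Percolation Literature.Probability.LatticeModels
open MeasureTheory Filter Set
open scoped Topology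
open Summit.CriticalPhenomena.CardyFormulaZ2.Theorems.HalfPlaneMarkDensityLaw.Negative

namespace OneArm

local notation3 "ν⁰[" v "]" =>
  max |(v : Site 2) 0 - (0 : Site 2) 0| ((v : Site 2) 1 - (0 : Site 2) 1)
local notation3 "ann₀[" r ", " R "]" => {v : Site 2 | 0 ≤ v 1 ∧ r ≤ ν⁰[v] ∧ ν⁰[v] ≤ R}
local notation3 "E₀[" r ", " R "]" =>
  openCrossing ann₀[r, R] {v : Site 2 | ν⁰[v] = r} {v : Site 2 | ν⁰[v] = R}
local notation3 "pilR₀[" a "]" =>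
  {v : Site 2 | (0 : Site 2) 0 + a ≤ v 0 ∧ v 0 ≤ (0 : Site 2) 0 + 2 * a ∧
    0 ≤ v 1 ∧ v 1 ≤ (0 : Site 2) 1 + 2 * a}
local notation3 "bar₀[" a "]" =>
  {v : Site 2 | (0 : Site 2) 0 - 2 * a ≤ v 0 ∧ v 0 ≤ (0 : Site 2) 0 + 2 * a ∧
    (0 : Site 2) 1 + a ≤ v 1 ∧ v 1 ≤ (0 : Site 2) 1 + 2 * a}
local notation3 "pilL₀[" a "]" =>
  {v : Site 2 | (0 : Site 2) 0 - 2 * a ≤ v 0 ∧ v 0 ≤ (0 : Site 2) 0 - a ∧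
    0 ≤ v 1 ∧ v 1 ≤ (0 : Site 2) 1 + 2 * a}
local notation3 "Ubox₀[" a "]" =>
  {v : Site 2 | (0 : Site 2) 0 - 2 * a ≤ v 0 ∧ v 0 ≤ (0 : Site 2) 0 + 2 * a ∧
    0 ≤ v 1 ∧ v 1 ≤ (0 : Site 2) 1 + 2 * a}
local notation3 "U₀[" a "]" =>
  openCrossing pilR₀[a] {v : Site 2 | v 1 = 0} {v : Site 2 | v 1 = (0 : Site 2) 1 + 2 * a} ∩
    openCrossing bar₀[a] {v : Site 2 | v 0 = (0 : Site 2) 0 - 2 * a}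
      {v : Site 2 | v 0 = (0 : Site 2) 0 + 2 * a} ∩
    openCrossing pilL₀[a] {v : Site 2 | v 1 = 0} {v : Site 2 | v 1 = (0 : Site 2) 1 + 2 * a}
local notation3 "P₂" => bondPercolation (zdGraph 2) half

/-! ## Deterministic half: two U's give a row-to-row crossing -/

/-- **A foot on the bottom row.** On a lattice configuration `ω ⊆ E(ℤ²)` in the U event `U₀[s]`
(`1 ≤ s`), every open path of the half-plane from a site `x` with `ν x ≤ s` to a site `y` with
`2s ≤ ν y` has its starting point `x` joined inside `ℤ×ℕ` to a vertex of the bottom-row segment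
`[s, 2s] × {0}`: the U catches the path (`HalfPlaneArm.uCatch`: `x` is joined to the left end of
the bar crossing), and the bar crossing meets the right pillar crossing (`HalfPlaneArm.meet`),
whose lower end lies on the bottom row with abscissa in `[s, 2s]`. [folklore] -/
private theorem stub_upperBlock_aux_foot {ω : BondConfig (Site 2)}
    (hω : ω ⊆ (zdGraph 2).edgeSet) {s : ℤ} (hs : 1 ≤ s) (hU : ω ∈ U₀[s]) {S : Set (Site 2)}
    (hS : ∀ v ∈ S, 0 ≤ v 1) {x y : Site 2} (hxy : ω ∈ openConnIn S x y) (hx : ν⁰[x] ≤ s)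
    (hy : 2 * s ≤ ν⁰[y]) :
    ∃ q : Site 2, q ∈ rowIcc s (2 * s) ∧ ω ∈ openConnIn halfPlane x q := by
  obtain ⟨⟨⟨xR, hxR, yR, hyR, hR⟩, ⟨xB, hxB, yB, hyB, hBar⟩⟩, ⟨xL, hxL, yL, hyL, hL⟩⟩ := hU
  have hb0 : (0 : Site 2) 0 = 0 := rfl
  have hb1 : (0 : Site 2) 1 = 0 := rfl
  have hxB' : xB 0 = (0 : Site 2) 0 - 2 * s := hxB
  have hyB' : yB 0 = (0 : Site 2) 0 + 2 * s := hyB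
  have hxR' : xR 1 = 0 := hxR
  have hyR' : yR 1 = (0 : Site 2) 1 + 2 * s := hyR
  have hs2 : (0 : ℝ) < Real.sqrt 2 := by positivity
  -- Step 1: the U catches the escaping path: `x ↔ xB` inside `S ∪ Ubox₀[s]`
  have h1 := HalfPlaneArm.uCatch (X := fun v : Site 2 => v 0) (Y := fun v : Site 2 => v 1)
    HalfPlaneArm.axis_X_le HalfPlaneArm.axis_Y_le (emb := squareLatticeEmbedding)
    isIsoradial_squareLatticeEmbedding_holds isRhombicTiling_squareLatticeEmbedding_holds
    (κ := Real.sqrt 2) hs2 HalfPlaneArm.axis_re HalfPlaneArm.axis_im hω (b := 0) (by simp) hs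
    hBar hxB hyB hR hxR hyR hL hxL hyL hS hxy hx hy
  -- Step 2: the bar crossing meets the right pillar crossing at a vertex `q`
  obtain ⟨q, -, -, ⟨x0, hx0, hqB⟩, -, ⟨x0', hx0', hqR⟩, -⟩ := HalfPlaneArm.meet
    (X := fun v : Site 2 => v 0) (Y := fun v : Site 2 => v 1) (emb := squareLatticeEmbedding)
    isIsoradial_squareLatticeEmbedding_holds isRhombicTiling_squareLatticeEmbedding_holds
    (κ := Real.sqrt 2) hs2 HalfPlaneArm.axis_re HalfPlaneArm.axis_im hω
    (S := bar₀[s]) (A := {xB}) (B := {yB}) (S' := pilR₀[s]) (A' := {xR}) (B' := {yR})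
    (a₁ := (0 : Site 2) 0 + s) (a₂ := (0 : Site 2) 0 + 2 * s)
    (c₁ := (0 : Site 2) 1 + s) (c₂ := (0 : Site 2) 1 + 2 * s) (by omega) (by omega)
    (fun v hv => hv.2.2) (fun v hv => by rw [mem_singleton_iff.1 hv]; omega)
    (fun v hv => by rw [mem_singleton_iff.1 hv]; omega) (fun v hv => ⟨hv.1, hv.2.1⟩)
    (fun v hv => by rw [mem_singleton_iff.1 hv]; omega)
    (fun v hv => by rw [mem_singleton_iff.1 hv]; omega)
    ⟨xB, mem_singleton _, yB, mem_singleton _, hBar⟩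
    ⟨xR, mem_singleton _, yR, mem_singleton _, hR⟩
  rw [mem_singleton_iff.1 hx0] at hqB
  rw [mem_singleton_iff.1 hx0'] at hqR
  -- Step 3: everything happens inside the half-plane; chain `x ↔ xB ↔ q ↔ xR`
  have hT1 : S ∪ Ubox₀[s] ⊆ halfPlane := by
    rintro v (hv | hv)
    exacts [hS v hv, hv.2.2.1]
  have hT2 : bar₀[s] ⊆ halfPlane := fun v hv => by
    have h := hv.2.2.1
    show 0 ≤ v 1
    omega
  have hT3 : pilR₀[s] ⊆ halfPlane := fun v hv => hv.2.2.1
  obtain ⟨hR1, hR2, -, -⟩ := hR.1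
  refine ⟨xR, ?_, HalfPlaneArm.conn_trans subset_rfl hT3
    (HalfPlaneArm.conn_trans hT1 hT2 h1 hqB) (HalfPlaneArm.conn_symm hqR)⟩
  simp only [rowIcc, mem_setOf_eq]
  exact ⟨hxR', by omega, by omega⟩

/-- **Deterministic inclusion.** On a lattice configuration `ω ⊆ E(ℤ²)` in
`E₀[r, R] ∩ U₀[r] ∩ U₀[a]` with `1 ≤ r ≤ a`, `2a ≤ R`, the bottom-row segments `[r, 2r] × {0}`
and `[a, 2a] × {0}` are joined by an open path of the half-plane `ℤ×ℕ`: the block crossing starts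
on `{ν = r} ⊆ {ν ≤ r} ⊆ {ν ≤ a}` and ends on `{ν = R} ⊆ {2a ≤ ν} ⊆ {2r ≤ ν}`, so by
`stub_upperBlock_aux_foot` at the scales `r` and `a` its starting point is joined inside `ℤ×ℕ` to
both segments. [folklore] -/
private theorem stub_upperBlock_aux_mem {ω : BondConfig (Site 2)} (hω : ω ⊆ (zdGraph 2).edgeSet)
    {r a R : ℤ} (hr : 1 ≤ r) (hra : r ≤ a) (haR : 2 * a ≤ R)
    (h : ω ∈ E₀[r, R] ∩ U₀[r] ∩ U₀[a]) :
    ω ∈ openCrossing halfPlane (rowIcc r (2 * r)) (rowIcc a (2 * a)) := by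
  obtain ⟨⟨⟨x, hx, y, hy, hxy⟩, hUr⟩, hUa⟩ := h
  have hx : ν⁰[x] = r := hx
  have hy : ν⁰[y] = R := hy
  have hS : ∀ v ∈ ann₀[r, R], 0 ≤ v 1 := fun v hv => hv.1
  obtain ⟨q, hq, hxq⟩ := stub_upperBlock_aux_foot hω hr hUr hS hxy (by omega) (by omega)
  obtain ⟨q', hq', hxq'⟩ :=
    stub_upperBlock_aux_foot hω (by omega) hUa hS hxy (by omega) (by omega)
  exact ⟨q, hq, q', hq',
    HalfPlaneArm.conn_trans subset_rfl subset_rfl (HalfPlaneArm.conn_symm hxq) hxq'⟩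

/-! ## Probabilistic half: Harris–FKG with the two U's -/

/-- STUB (lattice) `stub_upperBlock`: the half-annulus block crossing probability is bounded ABOVE
by a constant times a Cardy-type row-to-row crossing probability: there are `c > 0` and `m₀` with
`c · P_{1/2}(E₀[r, R]) ≤ P_{1/2}[[r, 2r]×{0} ↔ [a, 2a]×{0} in ℤ×ℕ]` whenever `m₀ ≤ r ≤ a` and
`2a ≤ R` (`c = c_U²`: the U events at the scales `r` and `a` have probability `≥ c_U` by RSW,
`HalfPlaneArm.real_U_ge`; Harris–FKG for the three increasing events, `HalfPlaneArm.harris₃`; and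
the deterministic inclusion `stub_upperBlock_aux_mem` on lattice configurations, which carry
`P_{1/2}`). [folklore] -/
theorem stub_upperBlock : ∃ c : ℝ, 0 < c ∧ ∃ m₀ : ℕ, ∀ r a R : ℤ, (m₀ : ℤ) ≤ r → r ≤ a → 2 * a ≤ R → c * μ.real (openCrossing {v : Site 2 | 0 ≤ v 1 ∧ r ≤ max |v 0 - (0 : Site 2) 0| (v 1 - (0 : Site 2) 1) ∧ max |v 0 - (0 : Site 2) 0| (v 1 - (0 : Site 2) 1) ≤ R} {v : Site 2 | max |v 0 - (0 : Site 2) 0| (v 1 - (0 : Site 2) 1) = r} {v : Site 2 | max |v 0 - (0 : Site 2) 0| (v 1 - (0 : Site 2) 1) = R}) ≤ μ.real (openCrossing halfPlane (rowIcc r (2 * r)) (rowIcc a (2 * a))) := by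
  obtain ⟨cU, hcU, mU, hU⟩ := HalfPlaneArm.real_U_ge (X := fun v : Site 2 => v 0)
    (Y := fun v : Site 2 => v 1) HalfPlaneArm.axis_X_le HalfPlaneArm.axis_Y_le
    HalfPlaneArm.axis_injective half HalfPlaneArm.axis_rswLR HalfPlaneArm.axis_rswTB
  refine ⟨cU * cU, by positivity, mU + 1, fun r a R hr hra haR => ?_⟩
  have hr1 : (1 : ℤ) ≤ r := by push_cast at hr; omega
  have hrU : (mU : ℤ) ≤ r := by push_cast at hr; omega
  have eUr := hU 0 r (by simp) hrU (by simp only [Pi.zero_apply]; omega)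
  have eUa := hU 0 a (by simp) (hrU.trans hra) (by simp only [Pi.zero_apply]; omega)
  have mE : MeasurableSet (E₀[r, R]) := measurableSet_openCrossing_of_countable _ _ _
  have mU' : ∀ s : ℤ, MeasurableSet (U₀[s]) := fun s =>
    ((measurableSet_openCrossing_of_countable _ _ _).inter
      (measurableSet_openCrossing_of_countable _ _ _)).inter
      (measurableSet_openCrossing_of_countable _ _ _)
  have uU : ∀ s : ℤ, IsUpperSet (U₀[s]) := fun s =>
    ((isUpperSet_openCrossing _ _ _).inter (isUpperSet_openCrossing _ _ _)).inter
      (isUpperSet_openCrossing _ _ _)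
  show cU * cU * (P₂).real _ ≤ (P₂).real _
  have hsub : (P₂).real (E₀[r, R] ∩ U₀[r] ∩ U₀[a]) ≤
      (P₂).real (openCrossing halfPlane (rowIcc r (2 * r)) (rowIcc a (2 * a))) := by
    refine ENNReal.toReal_mono (measure_ne_top _ _) (measure_mono_ae ?_)
    filter_upwards [ae_subset_edgeSet (zdGraph 2) half] with ω hω h
    exact stub_upperBlock_aux_mem hω hr1 hra haR h
  calc cU * cU * (P₂).real E₀[r, R] = (P₂).real E₀[r, R] * cU * cU := by ring
    _ ≤ (P₂).real E₀[r, R] * (P₂).real U₀[r] * (P₂).real U₀[a] := by gcongr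
    _ ≤ _ := HalfPlaneArm.harris₃ half (isUpperSet_openCrossing _ _ _) (uU r) (uU a) mE (mU' r)
      (mU' a)
    _ ≤ _ := hsub

end OneArm

end Summit.CriticalPhenomena.CardyFormulaZ2.Cruxes.HalfPlaneMarkDensityLaw.SketchLine

end
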